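import Mathlib.Analysis.SpecialFunctions.Pow.Real
import Mathlib.Analysis.Real.Sqrt
import Mathlib.Algebra.Order.BigOperators.Ring.Finset
import HarnessLib

/-!
# K1L_D (stmt-AnomalousDissipation-27980), stub `stub_oneLevelL_IW`: ASSEMBLY of the dissipation-dominated bound (DD) from the cell-side pieces
# (helper; `--supports … --as helper`; real-variable core of S3′ step B of `Lines/onelevel-S3assembly-plan.md`, uncut ledger F-lead-7)

In the uncut window ledger the pairing `⟨y, e_k⟩` of a test state `y` with the window error splits into four real numbers:
`A_diag` (same-sector tracking errors, (V_G): `|·| ≤ Σ_ℓ y_ℓ·η₁ d_ℓ σ_ℓ`), `A_cross` (cross-sector transfer, (X_G): `|·| ≤ η₂ √(Σ d σ²) √(Σ d y²)`),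
`A_fast` (fast-mode content of the error against the fast part of `y`: `|·| ≤ Y_f·(√(Σ κ_ℓ σ_ℓ²) + η₃ F)` with corrector fractions `κ_ℓ ≤ η₄² d_ℓ`,
(C_G)) and `A_leak` (slow content generated by the fast part `F` of the state, (F_G): `|·| ≤ Σ_ℓ y_ℓ √κ′_ℓ F_ℓ`, `κ′_ℓ ≤ η₅² d_ℓ`, `Σ F_ℓ² ≤ F²`), while
the two dissipations are bounded BELOW ((E_G) + explicit flat decay; level-`m` dynamics kills fast modes): `𝔇 ≥ c (Σ d_ℓ σ_ℓ² + F²)`,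
`𝔇* ≥ c (Σ d_ℓ y_ℓ² + Y_f²)`.  Then `|A_diag + A_cross + A_fast + A_leak| ≤ ((η₁ + η₂ + η₃ + η₄ + η₅)/c)·√𝔇·√𝔇*` — the (DD) hypothesis of
`window_ledger_abs` with `η = (Σηᵢ)/c`.  Finite Cauchy–Schwarz only.  Infrastructure for rung F-D1.A0; NOT a proof of the crux or of anomalous dissipation.
-/

set_option linter.dupNamespace false

namespace Summit.AnomalousDissipation.AnomalousDissipation.Theorems.SolenoidalFractalHomogenisation.LagrangianStep

open Finset

/-- Weighted Cauchy–Schwarz: `Σ_ℓ y_ℓ (d_ℓ σ_ℓ) ≤ √(Σ d σ²) √(Σ d y²)` for `d ≥ 0`. -/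
theorem sum_weight_mul_le {ι : Type*} (s : Finset ι) (d σ y : ι → ℝ) (hd : ∀ i, 0 ≤ d i) :
    ∑ i ∈ s, y i * (d i * σ i) ≤ Real.sqrt (∑ i ∈ s, d i * σ i ^ 2) * Real.sqrt (∑ i ∈ s, d i * y i ^ 2) := by
  have h := Real.sum_mul_le_sqrt_mul_sqrt s (fun i => Real.sqrt (d i) * σ i) (fun i => Real.sqrt (d i) * y i)
  have h1 : ∀ i, (Real.sqrt (d i) * σ i) ^ 2 = d i * σ i ^ 2 := fun i => by rw [mul_pow, Real.sq_sqrt (hd i)]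
  have h2 : ∀ i, (Real.sqrt (d i) * y i) ^ 2 = d i * y i ^ 2 := fun i => by rw [mul_pow, Real.sq_sqrt (hd i)]
  have h3 : ∀ i, Real.sqrt (d i) * σ i * (Real.sqrt (d i) * y i) = y i * (d i * σ i) := fun i => by
    have := Real.mul_self_sqrt (hd i)
    calc Real.sqrt (d i) * σ i * (Real.sqrt (d i) * y i) = (Real.sqrt (d i) * Real.sqrt (d i)) * σ i * y i := by ring
      _ = y i * (d i * σ i) := by rw [this]; ring
  simp only [h1, h2, h3] at h
  exact h

/-- Mixed Cauchy–Schwarz for the leak: `Σ_ℓ y_ℓ √κ′_ℓ F_ℓ ≤ η √(Σ d y²) √(Σ F²)` when `κ′_ℓ ≤ η² d_ℓ`, `η ≥ 0`, `y ≥ 0`, `F ≥ 0`. -/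
theorem sum_leak_le {ι : Type*} (s : Finset ι) (d κ y F : ι → ℝ) {η : ℝ} (hη : 0 ≤ η) (hd : ∀ i, 0 ≤ d i)
    (hκd : ∀ i, κ i ≤ η ^ 2 * d i) (hy : ∀ i, 0 ≤ y i) (hF : ∀ i, 0 ≤ F i) :
    ∑ i ∈ s, y i * Real.sqrt (κ i) * F i ≤ η * Real.sqrt (∑ i ∈ s, d i * y i ^ 2) * Real.sqrt (∑ i ∈ s, F i ^ 2) := by
  have hstep : ∀ i, y i * Real.sqrt (κ i) * F i ≤ (η * (Real.sqrt (d i) * y i)) * F i := by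
    intro i
    have h1 : Real.sqrt (κ i) ≤ η * Real.sqrt (d i) := by
      rw [← Real.sqrt_sq hη, ← Real.sqrt_mul (sq_nonneg _)]
      exact Real.sqrt_le_sqrt (hκd i)
    have := mul_le_mul_of_nonneg_left h1 (hy i)
    have := mul_le_mul_of_nonneg_right this (hF i)
    linarith [this]
  calc ∑ i ∈ s, y i * Real.sqrt (κ i) * F i ≤ ∑ i ∈ s, (η * (Real.sqrt (d i) * y i)) * F i := Finset.sum_le_sum fun i _ => hstep i
    _ = η * ∑ i ∈ s, (Real.sqrt (d i) * y i) * F i := by rw [Finset.mul_sum]; refine Finset.sum_congr rfl fun i _ => ?_; ring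
    _ ≤ η * (Real.sqrt (∑ i ∈ s, (Real.sqrt (d i) * y i) ^ 2) * Real.sqrt (∑ i ∈ s, F i ^ 2)) :=
        mul_le_mul_of_nonneg_left (Real.sum_mul_le_sqrt_mul_sqrt s _ _) hη
    _ = η * Real.sqrt (∑ i ∈ s, d i * y i ^ 2) * Real.sqrt (∑ i ∈ s, F i ^ 2) := by
        have : ∀ i, (Real.sqrt (d i) * y i) ^ 2 = d i * y i ^ 2 := fun i => by rw [mul_pow, Real.sq_sqrt (hd i)]
        simp only [this]; ring

/-- **(DD) assembly.**  See the module docstring: the four pieces of `⟨y, e⟩` and the two dissipation lower bounds give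
`|A_diag + A_cross + A_fast + A_leak| ≤ ((η₁+η₂+η₃+η₄+η₅)/c) √𝔇 √𝔇*`. -/
theorem dd_assembly {ι : Type*} (s : Finset ι) (d σ y κ κ' Fℓ : ι → ℝ) {F Yf D Dstar c η₁ η₂ η₃ η₄ η₅ Adiag Across Afast Aleak : ℝ}
    (hd : ∀ i, 0 ≤ d i) (hy : ∀ i, 0 ≤ y i) (hFℓ : ∀ i, 0 ≤ Fℓ i)
    (hF : 0 ≤ F) (hYf : 0 ≤ Yf) (hc : 0 < c)
    (hη₁ : 0 ≤ η₁) (hη₂ : 0 ≤ η₂) (hη₃ : 0 ≤ η₃) (hη₄ : 0 ≤ η₄) (hη₅ : 0 ≤ η₅)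
    (hκd : ∀ i, κ i ≤ η₄ ^ 2 * d i) (hκ'd : ∀ i, κ' i ≤ η₅ ^ 2 * d i) (hFsum : ∑ i ∈ s, Fℓ i ^ 2 ≤ F ^ 2)
    (hdiag : |Adiag| ≤ ∑ i ∈ s, y i * (η₁ * d i * σ i))
    (hcross : |Across| ≤ η₂ * Real.sqrt (∑ i ∈ s, d i * σ i ^ 2) * Real.sqrt (∑ i ∈ s, d i * y i ^ 2))
    (hfast : |Afast| ≤ Yf * (Real.sqrt (∑ i ∈ s, κ i * σ i ^ 2) + η₃ * F))
    (hleak : |Aleak| ≤ ∑ i ∈ s, y i * Real.sqrt (κ' i) * Fℓ i)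
    (hD : c * (∑ i ∈ s, d i * σ i ^ 2 + F ^ 2) ≤ D) (hDstar : c * (∑ i ∈ s, d i * y i ^ 2 + Yf ^ 2) ≤ Dstar) :
    |Adiag + Across + Afast + Aleak| ≤ (η₁ + η₂ + η₃ + η₄ + η₅) / c * Real.sqrt D * Real.sqrt Dstar := by
  -- the four basic nonnegative quantities
  set Sσ : ℝ := ∑ i ∈ s, d i * σ i ^ 2 with hSσ
  set Sy : ℝ := ∑ i ∈ s, d i * y i ^ 2 with hSy
  have hSσ0 : 0 ≤ Sσ := Finset.sum_nonneg fun i _ => mul_nonneg (hd i) (sq_nonneg _)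
  have hSy0 : 0 ≤ Sy := Finset.sum_nonneg fun i _ => mul_nonneg (hd i) (sq_nonneg _)
  -- `P := √(Sσ + F²) ≤ √(D/c)`, `Q := √(Sy + Yf²) ≤ √(D*/c)`; every piece is `≤ ηᵢ P Q`
  set P : ℝ := Real.sqrt (Sσ + F ^ 2) with hP
  set Q : ℝ := Real.sqrt (Sy + Yf ^ 2) with hQ
  have hP0 : 0 ≤ P := Real.sqrt_nonneg _
  have hQ0 : 0 ≤ Q := Real.sqrt_nonneg _
  have hσP : Real.sqrt Sσ ≤ P := Real.sqrt_le_sqrt (by nlinarith)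
  have hFP : F ≤ P := by rw [hP]; calc F = Real.sqrt (F ^ 2) := (Real.sqrt_sq hF).symm
    _ ≤ _ := Real.sqrt_le_sqrt (by linarith)
  have hyQ : Real.sqrt Sy ≤ Q := Real.sqrt_le_sqrt (by nlinarith)
  have hYQ : Yf ≤ Q := by rw [hQ]; calc Yf = Real.sqrt (Yf ^ 2) := (Real.sqrt_sq hYf).symm
    _ ≤ _ := Real.sqrt_le_sqrt (by linarith)
  -- diag
  have h1 : |Adiag| ≤ η₁ * P * Q := by
    have hcs := sum_weight_mul_le s d σ y hd
    have : ∑ i ∈ s, y i * (η₁ * d i * σ i) = η₁ * ∑ i ∈ s, y i * (d i * σ i) := by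
      rw [Finset.mul_sum]; exact Finset.sum_congr rfl fun i _ => by ring
    rw [this] at hdiag
    calc |Adiag| ≤ η₁ * ∑ i ∈ s, y i * (d i * σ i) := hdiag
      _ ≤ η₁ * (Real.sqrt Sσ * Real.sqrt Sy) := mul_le_mul_of_nonneg_left hcs hη₁
      _ ≤ η₁ * (P * Q) := mul_le_mul_of_nonneg_left (mul_le_mul hσP hyQ (Real.sqrt_nonneg _) hP0) hη₁
      _ = η₁ * P * Q := by ring
  -- cross
  have h2 : |Across| ≤ η₂ * P * Q := by
    calc |Across| ≤ η₂ * Real.sqrt Sσ * Real.sqrt Sy := hcross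
      _ = η₂ * (Real.sqrt Sσ * Real.sqrt Sy) := by ring
      _ ≤ η₂ * (P * Q) := mul_le_mul_of_nonneg_left (mul_le_mul hσP hyQ (Real.sqrt_nonneg _) hP0) hη₂
      _ = η₂ * P * Q := by ring
  -- fast: `√(Σ κ σ²) ≤ η₄ √Sσ ≤ η₄ P`, `η₃ F ≤ η₃ P`, `Yf ≤ Q`
  have h3 : |Afast| ≤ (η₃ + η₄) * P * Q := by
    have hk : Real.sqrt (∑ i ∈ s, κ i * σ i ^ 2) ≤ η₄ * Real.sqrt Sσ := by
      rw [← Real.sqrt_sq hη₄, ← Real.sqrt_mul (sq_nonneg _)]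
      refine Real.sqrt_le_sqrt ?_
      rw [hSσ, Finset.mul_sum]
      exact Finset.sum_le_sum fun i _ => by
        have := mul_le_mul_of_nonneg_right (hκd i) (sq_nonneg (σ i)); linarith [this]
    have hin : Real.sqrt (∑ i ∈ s, κ i * σ i ^ 2) + η₃ * F ≤ (η₃ + η₄) * P := by
      have a1 : η₄ * Real.sqrt Sσ ≤ η₄ * P := mul_le_mul_of_nonneg_left hσP hη₄
      have a2 : η₃ * F ≤ η₃ * P := mul_le_mul_of_nonneg_left hFP hη₃
      linarith
    calc |Afast| ≤ Yf * (Real.sqrt (∑ i ∈ s, κ i * σ i ^ 2) + η₃ * F) := hfast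
      _ ≤ Q * ((η₃ + η₄) * P) := mul_le_mul hYQ hin (by positivity) hQ0
      _ = (η₃ + η₄) * P * Q := by ring
  -- leak
  have h4 : |Aleak| ≤ η₅ * P * Q := by
    have hl := sum_leak_le s d κ' y Fℓ hη₅ hd hκ'd hy hFℓ
    have hFl : Real.sqrt (∑ i ∈ s, Fℓ i ^ 2) ≤ P := (Real.sqrt_le_sqrt hFsum).trans (by rw [Real.sqrt_sq hF]; exact hFP)
    calc |Aleak| ≤ ∑ i ∈ s, y i * Real.sqrt (κ' i) * Fℓ i := hleak
      _ ≤ η₅ * Real.sqrt Sy * Real.sqrt (∑ i ∈ s, Fℓ i ^ 2) := hl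
      _ = η₅ * (Real.sqrt Sy * Real.sqrt (∑ i ∈ s, Fℓ i ^ 2)) := by ring
      _ ≤ η₅ * (Q * P) := mul_le_mul_of_nonneg_left (mul_le_mul hyQ hFl (Real.sqrt_nonneg _) hQ0) hη₅
      _ = η₅ * P * Q := by ring
  -- `P Q ≤ √D √D* / c`
  have hPQ : P * Q ≤ Real.sqrt D * Real.sqrt Dstar / c := by
    have hP' : P ≤ Real.sqrt (D / c) := Real.sqrt_le_sqrt (by rw [le_div_iff₀ hc]; linarith)
    have hQ' : Q ≤ Real.sqrt (Dstar / c) := Real.sqrt_le_sqrt (by rw [le_div_iff₀ hc]; linarith)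
    calc P * Q ≤ Real.sqrt (D / c) * Real.sqrt (Dstar / c) := mul_le_mul hP' hQ' hQ0 (Real.sqrt_nonneg _)
      _ = Real.sqrt D * Real.sqrt Dstar / c := by
          rw [Real.sqrt_div' _ hc.le, Real.sqrt_div' _ hc.le, div_mul_div_comm, Real.mul_self_sqrt hc.le]
  have htot : |Adiag + Across + Afast + Aleak| ≤ (η₁ + η₂ + η₃ + η₄ + η₅) * (P * Q) := by
    have := abs_add_le (Adiag + Across + Afast) Aleak
    have := abs_add_le (Adiag + Across) Afast
    have := abs_add_le Adiag Across
    nlinarith [h1, h2, h3, h4, mul_nonneg hP0 hQ0]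
  have hηs : 0 ≤ η₁ + η₂ + η₃ + η₄ + η₅ := by positivity
  calc |Adiag + Across + Afast + Aleak| ≤ (η₁ + η₂ + η₃ + η₄ + η₅) * (P * Q) := htot
    _ ≤ (η₁ + η₂ + η₃ + η₄ + η₅) * (Real.sqrt D * Real.sqrt Dstar / c) := mul_le_mul_of_nonneg_left hPQ hηs
    _ = (η₁ + η₂ + η₃ + η₄ + η₅) / c * Real.sqrt D * Real.sqrt Dstar := by ring

/-- **(DD) assembly, operator form of the leak** (v12 companions, p4 g12 L4c): same as `dd_assembly` but with the leak given in the
`x`-WEIGHTED OUTPUT form `|A_leak| ≤ F · √(Σ_ℓ κ′_ℓ y_ℓ²)` (slow output of the fast content paired with `y`, Cauchy–Schwarz against the weighted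
output energy `Σ out²/x ≤ (C+C₂δ)‖f‖²`), `κ′_ℓ ≤ η₅² d_ℓ`. -/
theorem dd_assembly_weighted {ι : Type*} (s : Finset ι) (d σ y κ κ' : ι → ℝ) {F Yf D Dstar c η₁ η₂ η₃ η₄ η₅ Adiag Across Afast Aleak : ℝ}
    (hd : ∀ i, 0 ≤ d i) (hF : 0 ≤ F) (hYf : 0 ≤ Yf) (hc : 0 < c)
    (hη₁ : 0 ≤ η₁) (hη₂ : 0 ≤ η₂) (hη₃ : 0 ≤ η₃) (hη₄ : 0 ≤ η₄) (hη₅ : 0 ≤ η₅)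
    (hκd : ∀ i, κ i ≤ η₄ ^ 2 * d i) (hκ'd : ∀ i, κ' i ≤ η₅ ^ 2 * d i)
    (hdiag : |Adiag| ≤ ∑ i ∈ s, y i * (η₁ * d i * σ i))
    (hcross : |Across| ≤ η₂ * Real.sqrt (∑ i ∈ s, d i * σ i ^ 2) * Real.sqrt (∑ i ∈ s, d i * y i ^ 2))
    (hfast : |Afast| ≤ Yf * (Real.sqrt (∑ i ∈ s, κ i * σ i ^ 2) + η₃ * F))
    (hleak : |Aleak| ≤ F * Real.sqrt (∑ i ∈ s, κ' i * y i ^ 2))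
    (hD : c * (∑ i ∈ s, d i * σ i ^ 2 + F ^ 2) ≤ D) (hDstar : c * (∑ i ∈ s, d i * y i ^ 2 + Yf ^ 2) ≤ Dstar) :
    |Adiag + Across + Afast + Aleak| ≤ (η₁ + η₂ + η₃ + η₄ + η₅) / c * Real.sqrt D * Real.sqrt Dstar := by
  -- reduce to `dd_assembly` with the one-term leak family `Fℓ := (F at a chosen index)`: simpler to redo the leak estimate directly.
  set Sσ : ℝ := ∑ i ∈ s, d i * σ i ^ 2 with hSσ
  set Sy : ℝ := ∑ i ∈ s, d i * y i ^ 2 with hSy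
  have hSσ0 : 0 ≤ Sσ := Finset.sum_nonneg fun i _ => mul_nonneg (hd i) (sq_nonneg _)
  have hSy0 : 0 ≤ Sy := Finset.sum_nonneg fun i _ => mul_nonneg (hd i) (sq_nonneg _)
  set P : ℝ := Real.sqrt (Sσ + F ^ 2) with hP
  set Q : ℝ := Real.sqrt (Sy + Yf ^ 2) with hQ
  have hP0 : 0 ≤ P := Real.sqrt_nonneg _
  have hQ0 : 0 ≤ Q := Real.sqrt_nonneg _
  have hσP : Real.sqrt Sσ ≤ P := Real.sqrt_le_sqrt (by nlinarith)
  have hFP : F ≤ P := by rw [hP]; calc F = Real.sqrt (F ^ 2) := (Real.sqrt_sq hF).symm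
    _ ≤ _ := Real.sqrt_le_sqrt (by linarith)
  have hyQ : Real.sqrt Sy ≤ Q := Real.sqrt_le_sqrt (by nlinarith)
  have hYQ : Yf ≤ Q := by rw [hQ]; calc Yf = Real.sqrt (Yf ^ 2) := (Real.sqrt_sq hYf).symm
    _ ≤ _ := Real.sqrt_le_sqrt (by linarith)
  have h1 : |Adiag| ≤ η₁ * P * Q := by
    have hcs := sum_weight_mul_le s d σ y hd
    have : ∑ i ∈ s, y i * (η₁ * d i * σ i) = η₁ * ∑ i ∈ s, y i * (d i * σ i) := by
      rw [Finset.mul_sum]; exact Finset.sum_congr rfl fun i _ => by ring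
    rw [this] at hdiag
    calc |Adiag| ≤ η₁ * ∑ i ∈ s, y i * (d i * σ i) := hdiag
      _ ≤ η₁ * (Real.sqrt Sσ * Real.sqrt Sy) := mul_le_mul_of_nonneg_left hcs hη₁
      _ ≤ η₁ * (P * Q) := mul_le_mul_of_nonneg_left (mul_le_mul hσP hyQ (Real.sqrt_nonneg _) hP0) hη₁
      _ = η₁ * P * Q := by ring
  have h2 : |Across| ≤ η₂ * P * Q := by
    calc |Across| ≤ η₂ * Real.sqrt Sσ * Real.sqrt Sy := hcross
      _ = η₂ * (Real.sqrt Sσ * Real.sqrt Sy) := by ring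
      _ ≤ η₂ * (P * Q) := mul_le_mul_of_nonneg_left (mul_le_mul hσP hyQ (Real.sqrt_nonneg _) hP0) hη₂
      _ = η₂ * P * Q := by ring
  have h3 : |Afast| ≤ (η₃ + η₄) * P * Q := by
    have hk : Real.sqrt (∑ i ∈ s, κ i * σ i ^ 2) ≤ η₄ * Real.sqrt Sσ := by
      rw [← Real.sqrt_sq hη₄, ← Real.sqrt_mul (sq_nonneg _)]
      refine Real.sqrt_le_sqrt ?_
      rw [hSσ, Finset.mul_sum]
      exact Finset.sum_le_sum fun i _ => by
        have := mul_le_mul_of_nonneg_right (hκd i) (sq_nonneg (σ i)); linarith [this]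
    have hin : Real.sqrt (∑ i ∈ s, κ i * σ i ^ 2) + η₃ * F ≤ (η₃ + η₄) * P := by
      have a1 : η₄ * Real.sqrt Sσ ≤ η₄ * P := mul_le_mul_of_nonneg_left hσP hη₄
      have a2 : η₃ * F ≤ η₃ * P := mul_le_mul_of_nonneg_left hFP hη₃
      linarith
    calc |Afast| ≤ Yf * (Real.sqrt (∑ i ∈ s, κ i * σ i ^ 2) + η₃ * F) := hfast
      _ ≤ Q * ((η₃ + η₄) * P) := mul_le_mul hYQ hin (by positivity) hQ0
      _ = (η₃ + η₄) * P * Q := by ring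
  have h4 : |Aleak| ≤ η₅ * P * Q := by
    have hk : Real.sqrt (∑ i ∈ s, κ' i * y i ^ 2) ≤ η₅ * Real.sqrt Sy := by
      rw [← Real.sqrt_sq hη₅, ← Real.sqrt_mul (sq_nonneg _)]
      refine Real.sqrt_le_sqrt ?_
      rw [hSy, Finset.mul_sum]
      exact Finset.sum_le_sum fun i _ => by
        have := mul_le_mul_of_nonneg_right (hκ'd i) (sq_nonneg (y i)); linarith [this]
    calc |Aleak| ≤ F * Real.sqrt (∑ i ∈ s, κ' i * y i ^ 2) := hleak
      _ ≤ P * (η₅ * Real.sqrt Sy) := mul_le_mul hFP hk (Real.sqrt_nonneg _) hP0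
      _ ≤ P * (η₅ * Q) := mul_le_mul_of_nonneg_left (mul_le_mul_of_nonneg_left hyQ hη₅) hP0
      _ = η₅ * P * Q := by ring
  have hPQ : P * Q ≤ Real.sqrt D * Real.sqrt Dstar / c := by
    have hP' : P ≤ Real.sqrt (D / c) := Real.sqrt_le_sqrt (by rw [le_div_iff₀ hc]; linarith)
    have hQ' : Q ≤ Real.sqrt (Dstar / c) := Real.sqrt_le_sqrt (by rw [le_div_iff₀ hc]; linarith)
    calc P * Q ≤ Real.sqrt (D / c) * Real.sqrt (Dstar / c) := mul_le_mul hP' hQ' hQ0 (Real.sqrt_nonneg _)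
      _ = Real.sqrt D * Real.sqrt Dstar / c := by
          rw [Real.sqrt_div' _ hc.le, Real.sqrt_div' _ hc.le, div_mul_div_comm, Real.mul_self_sqrt hc.le]
  have htot : |Adiag + Across + Afast + Aleak| ≤ (η₁ + η₂ + η₃ + η₄ + η₅) * (P * Q) := by
    have := abs_add_le (Adiag + Across + Afast) Aleak
    have := abs_add_le (Adiag + Across) Afast
    have := abs_add_le Adiag Across
    nlinarith [h1, h2, h3, h4, mul_nonneg hP0 hQ0]
  have hηs : 0 ≤ η₁ + η₂ + η₃ + η₄ + η₅ := by positivity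
  calc |Adiag + Across + Afast + Aleak| ≤ (η₁ + η₂ + η₃ + η₄ + η₅) * (P * Q) := htot
    _ ≤ (η₁ + η₂ + η₃ + η₄ + η₅) * (Real.sqrt D * Real.sqrt Dstar / c) := mul_le_mul_of_nonneg_left hPQ hηs
    _ = (η₁ + η₂ + η₃ + η₄ + η₅) / c * Real.sqrt D * Real.sqrt Dstar := by ring

/-- **(DD) assembly, v12 operator forms**: as `dd_assembly_weighted`, with the cross term bounded against the FULL source/target profiles
`√(Σ d σ² + F²)·√(Σ d y² + Y_f²)` ((X_G⁺): sources and targets may carry fast content). -/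
theorem dd_assembly_op {ι : Type*} (s : Finset ι) (d σ y κ κ' : ι → ℝ) {F Yf D Dstar c η₁ η₂ η₃ η₄ η₅ Adiag Across Afast Aleak : ℝ}
    (hd : ∀ i, 0 ≤ d i) (hF : 0 ≤ F) (hYf : 0 ≤ Yf) (hc : 0 < c)
    (hη₁ : 0 ≤ η₁) (hη₂ : 0 ≤ η₂) (hη₃ : 0 ≤ η₃) (hη₄ : 0 ≤ η₄) (hη₅ : 0 ≤ η₅)
    (hκd : ∀ i, κ i ≤ η₄ ^ 2 * d i) (hκ'd : ∀ i, κ' i ≤ η₅ ^ 2 * d i)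
    (hdiag : |Adiag| ≤ ∑ i ∈ s, y i * (η₁ * d i * σ i))
    (hcross : |Across| ≤ η₂ * Real.sqrt (∑ i ∈ s, d i * σ i ^ 2 + F ^ 2) * Real.sqrt (∑ i ∈ s, d i * y i ^ 2 + Yf ^ 2))
    (hfast : |Afast| ≤ Yf * (Real.sqrt (∑ i ∈ s, κ i * σ i ^ 2) + η₃ * F))
    (hleak : |Aleak| ≤ F * Real.sqrt (∑ i ∈ s, κ' i * y i ^ 2))
    (hD : c * (∑ i ∈ s, d i * σ i ^ 2 + F ^ 2) ≤ D) (hDstar : c * (∑ i ∈ s, d i * y i ^ 2 + Yf ^ 2) ≤ Dstar) :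
    |Adiag + Across + Afast + Aleak| ≤ (η₁ + η₂ + η₃ + η₄ + η₅) / c * Real.sqrt D * Real.sqrt Dstar := by
  set Sσ : ℝ := ∑ i ∈ s, d i * σ i ^ 2 with hSσ
  set Sy : ℝ := ∑ i ∈ s, d i * y i ^ 2 with hSy
  have hSσ0 : 0 ≤ Sσ := Finset.sum_nonneg fun i _ => mul_nonneg (hd i) (sq_nonneg _)
  have hSy0 : 0 ≤ Sy := Finset.sum_nonneg fun i _ => mul_nonneg (hd i) (sq_nonneg _)
  set P : ℝ := Real.sqrt (Sσ + F ^ 2) with hP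
  set Q : ℝ := Real.sqrt (Sy + Yf ^ 2) with hQ
  have hP0 : 0 ≤ P := Real.sqrt_nonneg _
  have hQ0 : 0 ≤ Q := Real.sqrt_nonneg _
  have hσP : Real.sqrt Sσ ≤ P := Real.sqrt_le_sqrt (by nlinarith)
  have hFP : F ≤ P := by rw [hP]; calc F = Real.sqrt (F ^ 2) := (Real.sqrt_sq hF).symm
    _ ≤ _ := Real.sqrt_le_sqrt (by linarith)
  have hyQ : Real.sqrt Sy ≤ Q := Real.sqrt_le_sqrt (by nlinarith)
  have hYQ : Yf ≤ Q := by rw [hQ]; calc Yf = Real.sqrt (Yf ^ 2) := (Real.sqrt_sq hYf).symm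
    _ ≤ _ := Real.sqrt_le_sqrt (by linarith)
  have h1 : |Adiag| ≤ η₁ * P * Q := by
    have hcs := sum_weight_mul_le s d σ y hd
    have : ∑ i ∈ s, y i * (η₁ * d i * σ i) = η₁ * ∑ i ∈ s, y i * (d i * σ i) := by
      rw [Finset.mul_sum]; exact Finset.sum_congr rfl fun i _ => by ring
    rw [this] at hdiag
    calc |Adiag| ≤ η₁ * ∑ i ∈ s, y i * (d i * σ i) := hdiag
      _ ≤ η₁ * (Real.sqrt Sσ * Real.sqrt Sy) := mul_le_mul_of_nonneg_left hcs hη₁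
      _ ≤ η₁ * (P * Q) := mul_le_mul_of_nonneg_left (mul_le_mul hσP hyQ (Real.sqrt_nonneg _) hP0) hη₁
      _ = η₁ * P * Q := by ring
  have h2 : |Across| ≤ η₂ * P * Q := hcross
  have h3 : |Afast| ≤ (η₃ + η₄) * P * Q := by
    have hk : Real.sqrt (∑ i ∈ s, κ i * σ i ^ 2) ≤ η₄ * Real.sqrt Sσ := by
      rw [← Real.sqrt_sq hη₄, ← Real.sqrt_mul (sq_nonneg _)]
      refine Real.sqrt_le_sqrt ?_
      rw [hSσ, Finset.mul_sum]
      exact Finset.sum_le_sum fun i _ => by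
        have := mul_le_mul_of_nonneg_right (hκd i) (sq_nonneg (σ i)); linarith [this]
    have hin : Real.sqrt (∑ i ∈ s, κ i * σ i ^ 2) + η₃ * F ≤ (η₃ + η₄) * P := by
      have a1 : η₄ * Real.sqrt Sσ ≤ η₄ * P := mul_le_mul_of_nonneg_left hσP hη₄
      have a2 : η₃ * F ≤ η₃ * P := mul_le_mul_of_nonneg_left hFP hη₃
      linarith
    calc |Afast| ≤ Yf * (Real.sqrt (∑ i ∈ s, κ i * σ i ^ 2) + η₃ * F) := hfast
      _ ≤ Q * ((η₃ + η₄) * P) := mul_le_mul hYQ hin (by positivity) hQ0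
      _ = (η₃ + η₄) * P * Q := by ring
  have h4 : |Aleak| ≤ η₅ * P * Q := by
    have hk : Real.sqrt (∑ i ∈ s, κ' i * y i ^ 2) ≤ η₅ * Real.sqrt Sy := by
      rw [← Real.sqrt_sq hη₅, ← Real.sqrt_mul (sq_nonneg _)]
      refine Real.sqrt_le_sqrt ?_
      rw [hSy, Finset.mul_sum]
      exact Finset.sum_le_sum fun i _ => by
        have := mul_le_mul_of_nonneg_right (hκ'd i) (sq_nonneg (y i)); linarith [this]
    calc |Aleak| ≤ F * Real.sqrt (∑ i ∈ s, κ' i * y i ^ 2) := hleak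
      _ ≤ P * (η₅ * Real.sqrt Sy) := mul_le_mul hFP hk (Real.sqrt_nonneg _) hP0
      _ ≤ P * (η₅ * Q) := mul_le_mul_of_nonneg_left (mul_le_mul_of_nonneg_left hyQ hη₅) hP0
      _ = η₅ * P * Q := by ring
  have hPQ : P * Q ≤ Real.sqrt D * Real.sqrt Dstar / c := by
    have hP' : P ≤ Real.sqrt (D / c) := Real.sqrt_le_sqrt (by rw [le_div_iff₀ hc]; linarith)
    have hQ' : Q ≤ Real.sqrt (Dstar / c) := Real.sqrt_le_sqrt (by rw [le_div_iff₀ hc]; linarith)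
    calc P * Q ≤ Real.sqrt (D / c) * Real.sqrt (Dstar / c) := mul_le_mul hP' hQ' hQ0 (Real.sqrt_nonneg _)
      _ = Real.sqrt D * Real.sqrt Dstar / c := by
          rw [Real.sqrt_div' _ hc.le, Real.sqrt_div' _ hc.le, div_mul_div_comm, Real.mul_self_sqrt hc.le]
  have htot : |Adiag + Across + Afast + Aleak| ≤ (η₁ + η₂ + η₃ + η₄ + η₅) * (P * Q) := by
    have := abs_add_le (Adiag + Across + Afast) Aleak
    have := abs_add_le (Adiag + Across) Afast
    have := abs_add_le Adiag Across
    nlinarith [h1, h2, h3, h4, mul_nonneg hP0 hQ0]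
  have hηs : 0 ≤ η₁ + η₂ + η₃ + η₄ + η₅ := by positivity
  calc |Adiag + Across + Afast + Aleak| ≤ (η₁ + η₂ + η₃ + η₄ + η₅) * (P * Q) := htot
    _ ≤ (η₁ + η₂ + η₃ + η₄ + η₅) * (Real.sqrt D * Real.sqrt Dstar / c) := mul_le_mul_of_nonneg_left hPQ hηs
    _ = (η₁ + η₂ + η₃ + η₄ + η₅) / c * Real.sqrt D * Real.sqrt Dstar := by ring

end Summit.AnomalousDissipation.AnomalousDissipation.Theorems.SolenoidalFractalHomogenisation.LagrangianStep
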